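import Summits.QuantumFields.BalabanUV.Beta.D1BFx.SortedEmbedding
import Summits.QuantumFields.BalabanUV.Beta.AxialDressingRootedBmHessian
import Summits.QuantumFields.BalabanUV.Beta.AxialCoordinateProjectorCoarse

/-!
# `BalabanUV.Beta.D1BFx.SortedEmbeddingWall` — road «BF-x», binder row D1, slot (K), X₃(ii) ROUTE T, brick «K-GLUE» PART 2: THE WALL'S LEG —
# the currency bridge of `SortedEmbedding` INSTANTIATED at TB1's leg `G := coDressKBmAt (toSite r) n (KInvStep n j)` (every level `j`; TB1 uses
# `j = 0`) with every hypothesis discharged from tree facts, for arbitrary jointly-periodic jets and for TA2's periodic ARRAYS of bi-localised jets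

WHY (for TB5).  After TA4 (`mixedVar ↦ 2·hessT (corner)`) and TB1 (`corner = diag(1,−1)·(sortK n G)^`, `TorusCombKKT.inv_MT_packed_eq`), the M-side
one-loop functional on the coarse torus is `2·hessT (blocksHat p (sortK n (flipRows G))) Ĵₛ Ĵₜ Ĵₛₜ` (`SortedEmbedding.sgnMat_mul_blocksHat`).  THIS
FILE rewrites it, with NO hypothesis left on the leg, as TA3b's fine-torus functional `2·hessT ((toF (flipRows G))^) …` over
`Site (d+1) (n·p) × Fib d`, to which `TorusTraceTadpole.tendsto_hessT_hessKer` applies (leg decaying and jointly periodic, jets = arrays).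
CONTENT (all [folklore] ∕ [our object]; every `d`, block side `n ≥ 1`, in-block root `toSite r`, level `j`, coarse period `p ≥ 1`):
* §0 [our object] `flipRows K` (negate the multiplier ROWS of a pack), **`sgnMat_mul_blocksHat : fromBlocks 1 0 0 (−1) · blocksHat p (sortK n K) =
  blocksHat p (sortK n (flipRows K))`** (TB1's corner is again a periodised pack), `flipRows_inr_row_off`, `isPeriodic₂_flipRows`, `summable_flipRows`.
* §1 the leg's hypotheses from the tree: `isPeriodic₂_of_blockCov` (block covariance under `n•t` ⟹ joint `(n·p)`-periodicity of every fibre),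
  `flipRows_inr_col_off`, and for `G_j := coDressKBmAt (toSite r) n (KInvStep n j)`: `isPeriodic₂_codressed`, `summable_codressed`,
  `codressed_inr_row_off` ∕ `codressed_inr_col_off` (an2's `shiftK_coDressKBmAt_KInvStep`, `decays_coDressKBmAt_KInvStep`,
  `coDressKBmAt_KInvStep_inr_row_off` ∕ `_col_off` BY NAME).
* §2 **`hessT_wallLeg_eq_embedded`**: for ANY jets `V V′ W : MKer (d+1) (Fib d)` with jointly `(n·p)`-periodic fibres and summable rows,
  `hessT (fromBlocks 1 0 0 (−1) · blocksHat p (sortK n G_j)) (blocksHat p (sortK n V)) (blocksHat p (sortK n V′)) (blocksHat p (sortK n W))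
     = hessT ((toF (flipRows G_j))^) ((toF V)^) ((toF V′)^) ((toF W)^)` (fine period `n·p`);
  **`hessT_wallLeg_arr_eq_embedded`**: the same with the jets TA2's arrays `arr (n·p) 𝒱` of bi-localised `𝒱 𝒱′ 𝒲` (hypotheses `BiLoc` only).
NOT HERE: the limit (TA3b), the jets = tables dictionary (TB4), the N-side (TB2), estimates.
HONEST FRAMING (cell contract, verbatim): «discharging `BetaPertH` makes Bałaban's UV stability UNCONDITIONAL — a real constructive-QFT result; it
is NOT the continuum limit and NOT the Clay problem.»  HONEST DEPENDENCY (verbatim): «continuum YM on T⁴ ⇐ BetaPertH ∧ nine spine estimates (0/9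
proved); BetaPertH ⇐ (D1) ∧ (D4) ∧ CAP+tail; G-an2-4 gates asym, D1 and NE2/3/4.»  [folklore] bookkeeping BY NAME; no `Prop` is minted, nothing is
cited, no wall binder is instantiated; 0 sorry.  NOT D1, NOT BetaPertH.  ABSOLUTE RULE (cell, verbatim): «No internally-minted statement may enter as
a cited fact. Every hypothesis is either kernel-proved in this package or a verbatim quotation of a PUBLISHED theorem with page reference. The
manuscript(s) under audit are NOT citable for their own disputed steps — they are the thing under adjudication; programme-internal
(2001/route/tribunal) claims are never citable.»  Provenance: D1 formalisation swarm, unit `b2b-balaban-beta-d1-formalise-leaf-03` (gen 8), 2026-08-20.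
-/

noncomputable section

namespace Summit.QuantumFields.BalabanUV.Beta.D1BFx.SortedEmbeddingWall

open Matrix
open Literature.Probability.LatticeModels (TorusSite Torus.proj)
open Literature.MathematicalPhysics.QuantumFieldTheory.Balaban1983to89
open Literature.MathematicalPhysics.QuantumFieldTheory.Balaban1983to89.Beta
open ExpKernelCalculus (MKer Decays BiLoc shiftK)
open AffineAveraging (box toSite)
open OneStepResolventKernel (Fib)
open OneStepKernelFamily (KInvStep)
open Summit.QuantumFields.BalabanUV.Beta.AxialDressingRooted (coDressKBmAt decays_coDressKBmAt_KInvStep shiftK_coDressKBmAt_KInvStep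
  coDressKBmAt_KInvStep_inr_row_off coDressKBmAt_KInvStep_inr_col_off)
open Summit.QuantumFields.BalabanUV.Beta.D1BFx.FibredPeriodisation
open Summit.QuantumFields.BalabanUV.Beta.D1BFx.SortedKernels
open Summit.QuantumFields.BalabanUV.Beta.D1BFx.SortedReblocking
open Summit.QuantumFields.BalabanUV.Beta.D1BFx.SortedPack
open Summit.QuantumFields.BalabanUV.Beta.D1BFx.SortedEmbedding
open Summit.QuantumFields.BalabanUV.Beta.D1BFx.PeriodicArrays (arr toF Kfib_toF isPeriodic₂_arr summable_abs_row_arr periodic_of_shiftK)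
open Summit.QuantumFields.BalabanUV.Beta.D1BFx.MixedVarPackedHess (hessT)
open scoped BigOperators

/-! ## §0 The multiplier-row sign flip as a periodised pack -/

section Flip
variable {D : ℕ} {F : Type*} {n p : ℕ}

/-- [our object] **MULTIPLIER-ROW SIGN FLIP** of a pack: `flipRows K x y (inl a) b = K x y (inl a) b`, `flipRows K x y (inr a) b = −K x y (inr a) b`
(TB1's `diag(1,−1)·Ĝ` as a pack: the `[[δd, −𝒬ᵀ],[𝒬, 0]]` vs `kkt` convention). -/
def flipRows (K : MKer D (F ⊕ F)) : MKer D (F ⊕ F) := fun x y a b =>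
  match a with
  | Sum.inl a => K x y (Sum.inl a) b
  | Sum.inr a => -K x y (Sum.inr a) b

/-- [our object] `flipRows` on field rows. -/
@[simp] theorem flipRows_inl (K : MKer D (F ⊕ F)) (x y : Fin D → ℤ) (a : F) (b : F ⊕ F) :
    flipRows K x y (Sum.inl a) b = K x y (Sum.inl a) b := rfl
/-- [our object] `flipRows` on multiplier rows. -/
@[simp] theorem flipRows_inr (K : MKer D (F ⊕ F)) (x y : Fin D → ℤ) (a : F) (b : F ⊕ F) :
    flipRows K x y (Sum.inr a) b = -K x y (Sum.inr a) b := rfl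

/-- [folklore] Periodisation of a negated fibred kernel (generic dimension). -/
theorem periodiseF_neg' [NeZero p] {α β : Type*} (K : FKer D α β) (i : Beta.Site D p × α) (j : Beta.Site D p × β) :
    periodiseF p (fun i' j' => -K i' j') i j = -periodiseF p K i j := by
  obtain ⟨x, a⟩ := i
  obtain ⟨y, b⟩ := j
  simp only [periodiseF_apply, periodise₂, Kfib_apply]
  exact tsum_neg

/-- [folklore] **THE SIGN MATRIX AS A PERIODISED PACK**: `fromBlocks 1 0 0 (−1) · blocksHat p (sortK n K) = blocksHat p (sortK n (flipRows K))`. -/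
theorem sgnMat_mul_blocksHat [Fintype F] [DecidableEq F] [NeZero n] [NeZero p] (K : MKer D (F ⊕ F)) :
    Matrix.fromBlocks (1 : Matrix (Beta.Site D p × (TorusSite D n × F)) _ ℝ) 0 0 (-1 : Matrix (Beta.Site D p × F) _ ℝ)
        * blocksHat p (sortK n K)
      = blocksHat p (sortK n (flipRows K)) := by
  rw [blocksHat, blocksHat, Matrix.fromBlocks_multiply]
  simp only [Matrix.one_mul, Matrix.zero_mul, add_zero, zero_add, Matrix.neg_mul]
  congr 1
  · ext ⟨x, m⟩ ⟨y, z, b⟩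
    rw [Matrix.neg_apply, Matrix.of_apply, Matrix.of_apply]
    show -(periodiseF p (fBL (sortK n K)) (x, m) (y, (z, b))) = periodiseF p (fBL (sortK n (flipRows K))) (x, m) (y, (z, b))
    rw [← periodiseF_neg']
    rfl
  · ext ⟨x, m⟩ ⟨y, m'⟩
    rw [Matrix.neg_apply, Matrix.of_apply, Matrix.of_apply]
    show -(periodiseF p (fBR (sortK n K)) (x, m) (y, m')) = periodiseF p (fBR (sortK n (flipRows K))) (x, m) (y, m')
    rw [← periodiseF_neg']
    rfl

/-- [folklore] `flipRows` preserves lattice support of the multiplier rows. -/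
theorem flipRows_inr_row_off [NeZero n] {K : MKer D (F ⊕ F)} (hK : ∀ y z f b, Torus.proj n y ≠ 0 → K y z (Sum.inr f) b = 0)
    {y : Fin D → ℤ} (z : Fin D → ℤ) (f : F) (b : F ⊕ F) (hy : Torus.proj n y ≠ 0) : flipRows K y z (Sum.inr f) b = 0 := by
  rw [flipRows_inr, hK y z f b hy, neg_zero]

/-- [folklore] `flipRows` preserves joint periodicity of the fibres. -/
theorem isPeriodic₂_flipRows {K : MKer D (F ⊕ F)} {s : ℕ} (hK : ∀ c c', IsPeriodic₂ s (fun x x' => K x x' c c')) :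
    ∀ c c', IsPeriodic₂ s (fun x x' => flipRows K x x' c c') := by
  rintro (a | a) c' x x' t
  · exact hK (Sum.inl a) c' x x' t
  · exact congrArg (fun r : ℝ => -r) (hK (Sum.inr a) c' x x' t)

/-- [folklore] `flipRows` preserves row summability of the fibres. -/
theorem summable_flipRows {K : MKer D (F ⊕ F)} (hK : ∀ c c' x, Summable fun x' => K x x' c c') :
    ∀ c c' x, Summable fun x' => flipRows K x x' c c' := by
  rintro (a | a) c' x
  · exact hK (Sum.inl a) c' x
  · exact (hK (Sum.inr a) c' x).neg

end Flip

variable {d : ℕ}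

/-! ## §1 The leg's hypotheses from the tree -/

section Leg
variable {n : ℕ} [NeZero n]

omit [NeZero n] in
/-- [folklore] Block covariance under the `n`-translations gives joint `(n·p)`-periodicity of every fibre. -/
theorem isPeriodic₂_of_blockCov {F : Type*} {K : MKer (d + 1) F} (hK : ∀ t : Fin (d + 1) → ℤ, shiftK ((n : ℤ) • t) K = K) (p : ℕ)
    (a b : F) : IsPeriodic₂ (n * p) (fun x x' => K x x' a b) := by
  intro x y t
  have h : ∀ t' : Fin (d + 1) → ℤ, shiftK (((n * p : ℕ) : ℤ) • t') K = K := fun t' => by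
    rw [Nat.cast_mul, mul_smul]; exact hK _
  exact periodic_of_shiftK h x y t a b

omit [NeZero n] in
/-- [folklore] `flipRows` preserves lattice support of the multiplier COLUMNS. -/
theorem flipRows_inr_col_off {F : Type*} {K : MKer (d + 1) (F ⊕ F)} (hK : ∀ x y a f, Torus.proj n y ≠ 0 → K x y a (Sum.inr f) = 0)
    (x : Fin (d + 1) → ℤ) {y : Fin (d + 1) → ℤ} (a : F ⊕ F) (f : F) (hy : Torus.proj n y ≠ 0) : flipRows K x y a (Sum.inr f) = 0 := by
  rcases a with a | a
  · rw [flipRows_inl, hK x y _ f hy]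
  · rw [flipRows_inr, hK x y _ f hy, neg_zero]

variable {r : Fin (d + 1) → ℕ} (hr : r ∈ box (d + 1) n) (j : ℕ)
include hr

omit hr in
/-- [folklore] Every fibre of the co-dressed step resolvent `G_j` is jointly `(n·p)`-periodic. -/
theorem isPeriodic₂_codressed (p : ℕ) (a b : Fib d) :
    IsPeriodic₂ (n * p) (fun x x' => coDressKBmAt (toSite r) n (KInvStep (d := d) n j) x x' a b) :=
  isPeriodic₂_of_blockCov (blockCov_of_neg fun t => shiftK_coDressKBmAt_KInvStep (toSite r) j t) p a b

/-- [folklore] Every fibre of `G_j` has absolutely summable rows. -/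
theorem summable_codressed (a b : Fib d) (x : Fin (d + 1) → ℤ) :
    Summable fun x' => coDressKBmAt (toSite r) n (KInvStep (d := d) n j) x x' a b := by
  obtain ⟨δ, C, hδ, -, hG⟩ := decays_coDressKBmAt_KInvStep (d := d) hr j
  exact (summable_abs_row hG hδ x a b).of_abs

omit hr in
/-- [folklore] Multiplier rows of `G_j` vanish off the coarse sublattice (an2, BY NAME). -/
theorem codressed_inr_row_off :
    ∀ y z f b, Torus.proj n y ≠ 0 → coDressKBmAt (toSite r) n (KInvStep (d := d) n j) y z (Sum.inr f) b = 0 :=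
  fun _ z f b hy => coDressKBmAt_KInvStep_inr_row_off (toSite r) j hy z f b

omit hr in
/-- [folklore] Multiplier columns of `G_j` vanish off the coarse sublattice (an2, BY NAME). -/
theorem codressed_inr_col_off :
    ∀ x y a f, Torus.proj n y ≠ 0 → coDressKBmAt (toSite r) n (KInvStep (d := d) n j) x y a (Sum.inr f) = 0 :=
  fun x _ a f hy => coDressKBmAt_KInvStep_inr_col_off (toSite r) j hy x a f

end Leg

/-! ## §2 The wall's leg in the two currencies -/

section Wall
variable {n : ℕ} [NeZero n] {r : Fin (d + 1) → ℕ} (hr : r ∈ box (d + 1) n) (j p : ℕ) [NeZero p]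
include hr

/-- [folklore] **THE M-SIDE LEG OF THE TORUS SLICE-TRANSFER IDENTITY IN TA3b's CURRENCY**: for ANY jets `V V′ W` with jointly `(n·p)`-periodic fibres
and summable rows,
`hessT (diag(1,−1)·(sortK n G_j)^blocks) (sortK n V)^blocks (sortK n V′)^blocks (sortK n W)^blocks = hessT ((toF (flipRows G_j))^) ((toF V)^) ((toF V′)^) ((toF W)^)`,
`G_j := coDressKBmAt (toSite r) n (KInvStep n j)`, fine period `n·p` on the right. -/
theorem hessT_wallLeg_eq_embedded {V V' W : MKer (d + 1) (Fib d)}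
    (hVp : ∀ c c', IsPeriodic₂ (n * p) (fun x x' => V x x' c c')) (hVr : ∀ c c' x, Summable fun x' => V x x' c c')
    (hV'p : ∀ c c', IsPeriodic₂ (n * p) (fun x x' => V' x x' c c')) (hV'r : ∀ c c' x, Summable fun x' => V' x x' c c')
    (hWp : ∀ c c', IsPeriodic₂ (n * p) (fun x x' => W x x' c c')) (hWr : ∀ c c' x, Summable fun x' => W x x' c c') :
    hessT (Matrix.fromBlocks (1 : Matrix (Beta.Site (d + 1) p × (TorusSite (d + 1) n × Fin (d + 1))) _ ℝ) 0 0
              (-1 : Matrix (Beta.Site (d + 1) p × Fin (d + 1)) _ ℝ)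
            * blocksHat p (sortK n (coDressKBmAt (toSite r) n (KInvStep (d := d) n j))))
        (blocksHat p (sortK n V)) (blocksHat p (sortK n V')) (blocksHat p (sortK n W))
      = hessT (Matrix.of (periodiseF (n * p) (toF (flipRows (coDressKBmAt (toSite r) n (KInvStep (d := d) n j))))))
          (Matrix.of (periodiseF (n * p) (toF V))) (Matrix.of (periodiseF (n * p) (toF V'))) (Matrix.of (periodiseF (n * p) (toF W))) := by
  rw [sgnMat_mul_blocksHat]
  exact hessT_blocksHat_eq_embedded (isPeriodic₂_flipRows (isPeriodic₂_codressed j p)) (summable_flipRows (summable_codressed hr j))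
    hVp hVr hV'p hV'r hWp hWr (fun y z f b hy => flipRows_inr_row_off (codressed_inr_row_off j) z f b hy)
    (fun x y a f hy => flipRows_inr_col_off (codressed_inr_col_off j) x a f hy)

/-- [folklore] **THE SAME WITH TA2's PERIODIC ARRAYS AS JETS**: for bi-localised `ℤ^{d+1}` jets `𝒱 𝒱′ 𝒲` (`BiLoc`, positive rates) and their arrays of
period `n·p`, the M-side torus functional in TB1's currency equals TA3b's `hessT ((toF (flipRows G_j))^) ((toF (arr (n·p) 𝒱))^) …` — the input of
`TorusTraceTadpole.tendsto_hessT_hessKer`. -/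
theorem hessT_wallLeg_arr_eq_embedded {V V' W : MKer (d + 1) (Fib d)} {pV qV pV' qV' pW qW : Fin (d + 1) → ℤ}
    {CV δV CV' δV' CW δW : ℝ} (hV : BiLoc V pV qV CV δV) (hδV : 0 < δV) (hV' : BiLoc V' pV' qV' CV' δV') (hδV' : 0 < δV')
    (hW : BiLoc W pW qW CW δW) (hδW : 0 < δW) :
    hessT (Matrix.fromBlocks (1 : Matrix (Beta.Site (d + 1) p × (TorusSite (d + 1) n × Fin (d + 1))) _ ℝ) 0 0
              (-1 : Matrix (Beta.Site (d + 1) p × Fin (d + 1)) _ ℝ)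
            * blocksHat p (sortK n (coDressKBmAt (toSite r) n (KInvStep (d := d) n j))))
        (blocksHat p (sortK n (arr (n * p) V))) (blocksHat p (sortK n (arr (n * p) V'))) (blocksHat p (sortK n (arr (n * p) W)))
      = hessT (Matrix.of (periodiseF (n * p) (toF (flipRows (coDressKBmAt (toSite r) n (KInvStep (d := d) n j))))))
          (Matrix.of (periodiseF (n * p) (toF (arr (n * p) V)))) (Matrix.of (periodiseF (n * p) (toF (arr (n * p) V'))))
          (Matrix.of (periodiseF (n * p) (toF (arr (n * p) W)))) :=
  hessT_wallLeg_eq_embedded hr j p (fun c c' => isPeriodic₂_arr (n * p) V c c') (fun c c' x => (summable_abs_row_arr hV hδV (n * p) c c' x).of_abs)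
    (fun c c' => isPeriodic₂_arr (n * p) V' c c') (fun c c' x => (summable_abs_row_arr hV' hδV' (n * p) c c' x).of_abs)
    (fun c c' => isPeriodic₂_arr (n * p) W c c') (fun c c' x => (summable_abs_row_arr hW hδW (n * p) c c' x).of_abs)

end Wall

end Summit.QuantumFields.BalabanUV.Beta.D1BFx.SortedEmbeddingWall

end
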